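import Mathlib.NumberTheory.ArithmeticFunction.Moebius
import Mathlib.Analysis.SpecialFunctions.Pow.Real
import Literature.NumberTheory.Sieve.LevelOfDistribution
import Literature.NumberTheory.Sieve.ParityBarrier
import HarnessLib

/-!
# The Friedlander–Iwaniec asymptotic sieve for primes: hypotheses and Theorem 1

Trunk T-SIEVE, family `parity` (definition item `defn-FIAsymptoticSieveHypotheses`, wanted by
`stmt-Parity-0603`, route Parity/AsymptoticSieve). Source: J. Friedlander, H. Iwaniec,
*Asymptotic sieve for primes*, Ann. of Math. 148 (1998) 1041–1065 [FriedlanderIwaniecASP1998], §1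
(hypotheses (1.4), (1.6)–(1.9), (1.16), (R), (R1), (B), (B1)–(B3)) and Theorem 1, eq. (1.17).

## Contents (all over the tree's `Literature.NumberTheory.Sieve.SieveSequence`; nothing of it is redefined)

* `SieveSequence.fiGamma C n = γ(n, C) = ∑_{d ∣ n, d ≤ C} μ(d)` (FI (B2)), with the API
  `fiGamma_one`, `fiGamma_of_lt_one`, `fiGamma_of_le` (`= [n = 1]` for `n ≤ C`),
  `fiGamma_eq_one_of_lt_primeFactors` (`= 1` when all prime factors exceed `C ≥ 1`),
  `abs_fiGamma_le` (`|γ(n, C)| ≤ τ(n)`);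
* `SieveSequence.fiBilinear A x N C = ∑_m |∑_{N < n ≤ 2N, mn ≤ x} γ(n, C) μ(mn) a_{mn}|`, the
  bilinear form of FI (B);
* `SieveSequence.fiLogSaving = 2 ^ 22`, the exponent of `log x` in (R) and (B);
* **`SieveSequence.FIAsymptoticSieveHypotheses A D δ Δ`** (`Prop`): the conjunction of FI's
  hypotheses of Theorem 1 for the sifted sequence `A` with level function `D = D(x)` and
  bilinear-range parameters `δ = δ(x)`, `Δ = Δ(x)`;
* the named fact **`fi_asymptotic_sieve_primes_loglog`** (`Prop`, FI Theorem 1 (1.17) in its working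
  regime `δ = (log x)^α`, `Δ = x^θ`, `α > 0`, `0 < θ < 1/3`, p. 1044): under these hypotheses
  `∑_{p ≤ x} a_p log p = H A(x) (1 + O(log log x / log x))` with `H = ∏_p (1 - g(p))(1 - 1/p)⁻¹`
  (`SieveSequence.HasDensityConstant`, ordered partial products); DISCHARGED downstream
  (`fi_asymptotic_sieve_primes_loglog_holds`, `AsymptoticSieveForPrimesTheorem1.lean`);
* RETIRED 2026-08-15 (refuted named fact, D-0026 verdict clean-up): the literal reading of Theorem 1
  over ALL parameter functions `δ, Δ ≥ 2`, formerly `def fi_asymptotic_sieve_primes : Prop` here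
  (with the ex-falso specialisation `fi_asymptotic_sieve_primes.loglog`), is FALSE; its statement is
  kept, negated and proved, as `not_fi_asymptotic_sieve_primes` (= `fi_asymptotic_sieve_primes_false`)
  in `AsymptoticSieveForPrimesCounterexample.lean` — see the section "Theorem 1 read literally" below.

## Faithfulness notes (read before using)

* FI's `A(x)` is the counting function `∑_{n ≤ x} a_n` itself (FI (1.3)), and `r_d(x)` is defined by
  `A_d(x) = g(d) A(x) + r_d(x)` (FI (1.7)). The tree's `SieveSequence` carries an abstract `size`;
  the hypothesis `size_eq : ∀ x, A.size x = A.congrSum 1 x` pins it to FI's `A(x)`, after which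
  `A.remainder d x` (`= A_d(x) - g(d) A.size x`) IS FI's `r_d(x)`.
* The savings in (R) and (B) are `(log x)^{-2^{22}}` — a FIXED huge power (`fiLogSaving`), exactly
  as printed in FI (R), (B) (and (9.7), (B̃)); it is NOT `(log x)^{-2}`. (§2 of FI reduces them to
  (R′), (B′) with `τ₅`-weights and saving `(log x)^{-3}` using (1.6) and `V(x) ≪ (log x)^{2^{20}}`.)
* (1.6) "`A_d(x) ≪ d⁻¹ τ(d)⁸ A(x)` uniformly in `d ≤ x^{1/3}`" and (1.4) "`A(x) ≫ A(√x)(log x)²`" carry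
  implied constants; they are existentially quantified, and all `x`-local hypotheses ((1.4), (1.6),
  (R), (R1), (B), `δ, Δ ≥ 2`) are demanded for all sufficiently large `x` (`∀ᶠ x in atTop`), the
  conclusion being an `=O[atTop]` statement. FI's constant in (1.17) "depends only on `g`"; the
  `IsBigO` phrasing (constant may depend on everything fixed, i.e. on `A, D, δ, Δ`) is implied by,
  and slightly weaker than, the printed uniformity — never stronger.
* (1.8)–(1.9) are global in the primes / in `y ≥ 2` as printed; multiplicativity of `g` (FI (1.7)ff)
  is the structure field `density_mult`; nonnegativity `a_n ≥ 0` (FI (1.1)) is `a_nonneg`.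
* (1.16) (support on squarefree integers) IS included: it is a hypothesis of Theorem 1. FI §9,
  Theorem 2 removes it at the cost of (9.1), (9.2) and the cubefree-level hypothesis (R₃); that
  variant is not vendored here.
* In (B) the outer sum is over all `m ≥ 1`; since `n ≥ 1` and `mn ≤ x` force `m ≤ x`, it is written
  over `m ∈ [1, x]` (extra `m` contribute empty inner sums). `N` and `C` are real parameters;
  `N < n ≤ 2N` is `n ∈ (⌊N⌋, ⌊2N⌋]` for `N ≥ 0`.
* `H` is supplied through `A.HasDensityConstant H` (the ordered Euler product converges to
  `H > 0` under (1.8)–(1.9), FI (1.12)–(1.14)); the error term is written `H A(x) log δ / log Δ`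
  literally as in (1.17).

## Mathlib search

Mathlib has `ArithmeticFunction.moebius` (`μ`), `Nat.divisors`, `Squarefree`, `Nat.primesLE`,
`ArithmeticFunction.sigma` (`σ 0 = τ`), `Asymptotics.IsBigO`, `Real.log`, `Real.rpow`,
`Real.sqrt`; no asymptotic sieve, no `γ(n, C)` (`rg "Friedlander|asymptotic sieve"` in Mathlib:
nothing). Tree: `SieveSequence`, `congrSum`, `remainder`, `HasLevel` (`LevelOfDistribution`),
`HasDensityConstant`, `bombieri_asymptotic_sieve` (`ParityBarrier`) are reused, not redefined.
-/

noncomputable section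

open Filter Asymptotics Finset
open scoped ArithmeticFunction.Moebius ArithmeticFunction.sigma

namespace Literature.NumberTheory.Sieve

namespace SieveSequence

/-! ### FI's bilinear form -/

/-- FI's truncated Möbius sum `γ(n, C) = ∑_{d ∣ n, d ≤ C} μ(d)` (so `γ(n, 1) = 1` for `n ≥ 1`).
[cite: FriedlanderIwaniecASP1998, (B2)] -/
def fiGamma (C : ℝ) (n : ℕ) : ℤ :=
  ∑ d ∈ n.divisors.filter (fun d : ℕ => (d : ℝ) ≤ C), μ d

/-- `γ(n, C)` unfolded. [cite: FriedlanderIwaniecASP1998, (B2)] -/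
theorem fiGamma_def (C : ℝ) (n : ℕ) :
    fiGamma C n = ∑ d ∈ n.divisors.filter (fun d : ℕ => (d : ℝ) ≤ C), μ d := rfl

/-- `γ(0, C) = 0` (no divisors are recorded for `0` in Mathlib's `Nat.divisors`). [folklore] -/
@[simp] theorem fiGamma_zero (C : ℝ) : fiGamma C 0 = 0 := by simp [fiGamma]

/-- `γ(n, 1) = 1` for `n ≥ 1` (only `d = 1` survives). [cite: FriedlanderIwaniecASP1998, Remarks after (B3)] -/
theorem fiGamma_one {n : ℕ} (hn : n ≠ 0) : fiGamma 1 n = 1 := by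
  rw [fiGamma]
  have h : n.divisors.filter (fun d : ℕ => (d : ℝ) ≤ 1) = {1} := by
    ext d
    simp only [Finset.mem_filter, Nat.mem_divisors, Finset.mem_singleton]
    constructor
    · rintro ⟨⟨hd, -⟩, hd1⟩
      have h0 : d ≠ 0 := fun h => hn (by simpa [h] using hd)
      have : (d : ℝ) ≤ (1 : ℕ) := by simpa using hd1
      have := Nat.cast_le.mp this
      omega
    · rintro rfl
      exact ⟨⟨one_dvd n, hn⟩, by simp⟩
  rw [h, Finset.sum_singleton, ArithmeticFunction.moebius_apply_one]

/-- For `C < 1` no divisor is recorded: `γ(n, C) = 0`. [folklore] -/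
theorem fiGamma_of_lt_one {C : ℝ} (hC : C < 1) (n : ℕ) : fiGamma C n = 0 := by
  rw [fiGamma]
  refine Finset.sum_eq_zero fun d hd => ?_
  exfalso
  obtain ⟨hd, hdC⟩ := Finset.mem_filter.mp hd
  have h1 : (1 : ℝ) ≤ d := by exact_mod_cast Nat.pos_of_mem_divisors hd
  linarith

/-- The complete Möbius sum: for `n ≤ C`, `γ(n, C) = ∑_{d ∣ n} μ(d) = [n = 1]`
(Möbius inversion, Mathlib `ArithmeticFunction.moebius_mul_coe_zeta`; also `n = 0`, both sides `0`).
[cite: FriedlanderIwaniecASP1998, (B2)] -/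
theorem fiGamma_of_le {C : ℝ} {n : ℕ} (hC : (n : ℝ) ≤ C) :
    fiGamma C n = if n = 1 then 1 else 0 := by
  rw [fiGamma]
  have hf : n.divisors.filter (fun d : ℕ => (d : ℝ) ≤ C) = n.divisors := by
    refine Finset.filter_true_of_mem fun d hd => le_trans ?_ hC
    exact_mod_cast Nat.divisor_le hd
  rw [hf]
  have h := congrArg (fun f : ArithmeticFunction ℤ => f n) ArithmeticFunction.moebius_mul_coe_zeta
  simp only [ArithmeticFunction.coe_mul_zeta_apply, ArithmeticFunction.one_apply] at h
  simpa using h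

/-- If every prime factor of `n ≥ 1` exceeds `C ≥ 1` then only `d = 1` is recorded: `γ(n, C) = 1`
(so `γ(p, C) = 1` for primes `p > C`). [cite: FriedlanderIwaniecASP1998, (B2)] -/
theorem fiGamma_eq_one_of_lt_primeFactors {C : ℝ} {n : ℕ} (hn : n ≠ 0) (hC : 1 ≤ C)
    (h : ∀ p ∈ n.primeFactors, C < p) : fiGamma C n = 1 := by
  rw [fiGamma]
  have hf : n.divisors.filter (fun d : ℕ => (d : ℝ) ≤ C) = {1} := by
    ext d
    simp only [Finset.mem_filter, Nat.mem_divisors, Finset.mem_singleton]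
    constructor
    · rintro ⟨⟨hd, -⟩, hdC⟩
      by_contra hd1
      have hd0 : d ≠ 0 := fun h0 => hn (by simpa [h0] using hd)
      have hd2 : d ≠ 1 := hd1
      obtain ⟨p, hp, hpd⟩ := Nat.exists_prime_and_dvd hd2
      have hpn : p ∈ n.primeFactors := Nat.mem_primeFactors.mpr ⟨hp, hpd.trans hd, hn⟩
      have hple : (p : ℝ) ≤ d := by exact_mod_cast Nat.le_of_dvd (Nat.pos_of_ne_zero hd0) hpd
      linarith [h p hpn]
    · rintro rfl
      exact ⟨⟨one_dvd n, hn⟩, by simpa using hC⟩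
  rw [hf, Finset.sum_singleton, ArithmeticFunction.moebius_apply_one]

/-- The trivial bound `|γ(n, C)| ≤ τ(n)`. [folklore] -/
theorem abs_fiGamma_le (C : ℝ) (n : ℕ) : |fiGamma C n| ≤ σ 0 n := by
  rw [fiGamma, ArithmeticFunction.sigma_zero_apply]
  refine (Finset.abs_sum_le_sum_abs _ _).trans ?_
  calc ∑ d ∈ n.divisors.filter (fun d : ℕ => (d : ℝ) ≤ C), |μ d|
      ≤ ∑ d ∈ n.divisors.filter (fun d : ℕ => (d : ℝ) ≤ C), (1 : ℤ) :=
        Finset.sum_le_sum fun d _ => ArithmeticFunction.abs_moebius_le_one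
    _ = ((n.divisors.filter (fun d : ℕ => (d : ℝ) ≤ C)).card : ℤ) := by simp
    _ ≤ (n.divisors.card : ℤ) := by
        exact_mod_cast Finset.card_filter_le _ _

/-- FI's bilinear form of hypothesis (B) at `x` with dyadic parameter `N` and truncation `C`:
`B(x; N, C) = ∑_{m ≥ 1} |∑_{N < n ≤ 2N, mn ≤ x} γ(n, C) μ(mn) a_{mn}|` (outer sum over `1 ≤ m ≤ x`,
which contains every `m` with a nonempty inner range). [cite: FriedlanderIwaniecASP1998, (B)] -/
def fiBilinear (A : SieveSequence) (x N C : ℝ) : ℝ :=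
  ∑ m ∈ Icc 1 ⌊x⌋₊,
    |∑ n ∈ (Ioc ⌊N⌋₊ ⌊2 * N⌋₊).filter (fun n : ℕ => ((m * n : ℕ) : ℝ) ≤ x),
      (fiGamma C n : ℝ) * (μ (m * n) : ℝ) * A.a (m * n)|

/-- `fiBilinear` unfolded. [cite: FriedlanderIwaniecASP1998, (B)] -/
theorem fiBilinear_def (A : SieveSequence) (x N C : ℝ) :
    A.fiBilinear x N C = ∑ m ∈ Icc 1 ⌊x⌋₊,
      |∑ n ∈ (Ioc ⌊N⌋₊ ⌊2 * N⌋₊).filter (fun n : ℕ => ((m * n : ℕ) : ℝ) ≤ x),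
        (fiGamma C n : ℝ) * (μ (m * n) : ℝ) * A.a (m * n)| := rfl

/-- The bilinear form is nonnegative (a sum of absolute values). [folklore] -/
theorem fiBilinear_nonneg (A : SieveSequence) (x N C : ℝ) : 0 ≤ A.fiBilinear x N C :=
  Finset.sum_nonneg fun _ _ => abs_nonneg _

/-- The exponent `2²²` of `log x` saved in FI's hypotheses (R) and (B):
`… ≤ A(x) (log x)^{-2^{22}}`. [cite: FriedlanderIwaniecASP1998, (R) and (B)] -/
def fiLogSaving : ℕ := 2 ^ 22

/-- `fiLogSaving = 4194304`. [folklore] -/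
theorem fiLogSaving_eq : fiLogSaving = 4194304 := by norm_num [fiLogSaving]

/-! ### The hypotheses of Theorem 1 -/

/-- **The hypotheses of the Friedlander–Iwaniec asymptotic sieve for primes** (Theorem 1) for a
sifted sequence `A = (a_n)_{n ≥ 1}`, `a_n ≥ 0`, with multiplicative density `g = A.density`, level
function `D = D(x)` and bilinear-range parameters `δ = δ(x)`, `Δ = Δ(x)`; writing
`A(x) = ∑_{n ≤ x} a_n`, `A_d(x) = ∑_{n ≤ x, d ∣ n} a_n`, `r_d(x) = A_d(x) - g(d) A(x)`:
* `size_eq`: the bundled `A.size` is FI's `A(x)` (so `A.remainder = r_d`);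
* (1.4) `A(x) ≫ A(√x) (log x)²`;
* (1.6) `A_d(x) ≪ d⁻¹ τ(d)⁸ A(x)` uniformly in `1 ≤ d ≤ x^{1/3}`;
* (1.8) `0 ≤ g(p) < 1` and `g(p) ≪ p⁻¹` for all primes `p`;
* (1.9) `∑_{p ≤ y} g(p) = log log y + c + O((log y)^{-10})` for `y ≥ 2`;
* (1.16) `a_n = 0` unless `n` is squarefree;
* (R1) `x^{2/3} < D(x) < x`, and `δ(x) ≥ 2`, `Δ(x) ≥ 2`;
* (R) `∑_{d ≤ D(x)} μ²(d) |r_d(t)| ≤ A(x) (log x)^{-2^{22}}` for all `t ≤ x`;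
* (B) for every `N` with `Δ⁻¹ √D < N < δ⁻¹ √x` (B1) and every `1 ≤ C ≤ x D⁻¹` (B3):
  `∑_m |∑_{N < n ≤ 2N, mn ≤ x} γ(n, C) μ(mn) a_{mn}| ≤ A(x) (log x)^{-2^{22}}`, `γ` as in (B2);
the `x`-local conditions being required for all sufficiently large `x`.
[cite: FriedlanderIwaniecASP1998, §1 (1.4), (1.6)-(1.9), (1.16), (R), (R1), (B), (B1)-(B3)] -/
def FIAsymptoticSieveHypotheses (A : SieveSequence) (D δ Δ : ℝ → ℝ) : Prop :=
  -- `A.size` is the counting function `A(x) = ∑_{n ≤ x} a_n` (FI (1.3), (1.7))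
  (∀ x, A.size x = A.congrSum 1 x) ∧
  -- (1.4)
  (∃ c : ℝ, 0 < c ∧ ∀ᶠ x : ℝ in atTop, c * A.size (Real.sqrt x) * Real.log x ^ 2 ≤ A.size x) ∧
  -- (1.6)
  (∃ K : ℝ, ∀ᶠ x : ℝ in atTop, ∀ d : ℕ, 1 ≤ d → (d : ℝ) ≤ x ^ (1 / 3 : ℝ) →
    A.congrSum d x ≤ K * (σ 0 d : ℝ) ^ 8 / d * A.size x) ∧
  -- (1.8)
  (∃ K : ℝ, ∀ p : ℕ, p.Prime → 0 ≤ A.density p ∧ A.density p < 1 ∧ A.density p ≤ K / p) ∧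
  -- (1.9)
  (∃ c K : ℝ, ∀ y : ℝ, 2 ≤ y →
    |(∑ p ∈ Nat.primesLE ⌊y⌋₊, A.density p) - (Real.log (Real.log y) + c)| ≤
      K / Real.log y ^ 10) ∧
  -- (1.16)
  (∀ n : ℕ, ¬Squarefree n → A.a n = 0) ∧
  -- (R1) and `δ, Δ ≥ 2`
  (∀ᶠ x : ℝ in atTop, x ^ (2 / 3 : ℝ) < D x ∧ D x < x ∧ 2 ≤ δ x ∧ 2 ≤ Δ x) ∧
  -- (R)
  (∀ᶠ x : ℝ in atTop, ∀ t : ℝ, t ≤ x →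
    ∑ d ∈ (Icc 1 ⌊D x⌋₊).filter Squarefree, |A.remainder d t| ≤
      A.size x / Real.log x ^ fiLogSaving) ∧
  -- (B) in the ranges (B1), (B3)
  (∀ᶠ x : ℝ in atTop, ∀ N : ℝ, Real.sqrt (D x) / Δ x < N → N < Real.sqrt x / δ x →
    ∀ C : ℝ, 1 ≤ C → C ≤ x / D x →
      A.fiBilinear x N C ≤ A.size x / Real.log x ^ fiLogSaving)

/-- The size normalisation packaged in the hypotheses: `A.size x = ∑_{n ≤ x} a_n`. [folklore] -/
theorem FIAsymptoticSieveHypotheses.size_eq {A : SieveSequence} {D δ Δ : ℝ → ℝ}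
    (h : A.FIAsymptoticSieveHypotheses D δ Δ) (x : ℝ) : A.size x = A.congrSum 1 x :=
  h.1 x

/-- Under the hypotheses, `A.remainder d x` is FI's `r_d(x) = A_d(x) - g(d) A(x)`. [cite: FriedlanderIwaniecASP1998, (1.7)] -/
theorem FIAsymptoticSieveHypotheses.remainder_eq {A : SieveSequence} {D δ Δ : ℝ → ℝ}
    (h : A.FIAsymptoticSieveHypotheses D δ Δ) (d : ℕ) (x : ℝ) :
    A.remainder d x = A.congrSum d x - A.density d * A.congrSum 1 x := by
  rw [SieveSequence.remainder, h.size_eq]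

/-- The squarefree-support clause (1.16). [cite: FriedlanderIwaniecASP1998, (1.16)] -/
theorem FIAsymptoticSieveHypotheses.a_eq_zero {A : SieveSequence} {D δ Δ : ℝ → ℝ}
    (h : A.FIAsymptoticSieveHypotheses D δ Δ) {n : ℕ} (hn : ¬Squarefree n) : A.a n = 0 :=
  h.2.2.2.2.2.1 n hn

/-- The density clause (1.8): `0 ≤ g(p) < 1` on primes. [cite: FriedlanderIwaniecASP1998, (1.8)] -/
theorem FIAsymptoticSieveHypotheses.density_prime {A : SieveSequence} {D δ Δ : ℝ → ℝ}
    (h : A.FIAsymptoticSieveHypotheses D δ Δ) {p : ℕ} (hp : p.Prime) :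
    0 ≤ A.density p ∧ A.density p < 1 := by
  obtain ⟨K, hK⟩ := h.2.2.2.1
  exact ⟨(hK p hp).1, (hK p hp).2.1⟩

end SieveSequence

/-! ### Theorem 1 read literally — RETIRED (refuted); Theorem 1 in its working regime

FI's Theorem 1 reads (p. 1044): "Assuming the above hypotheses" — among them (B) in the range (B1)
`Δ⁻¹ √D < N < δ⁻¹ √x` "for some `δ = δ(x) ≥ 2` and `Δ = Δ(x) ≥ 2`" — "we have (1.17)
`∑_{p ≤ x} a_p log p = H A(x) {1 + O(log δ(x) / log Δ(x))}` where the implied constant depends only on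
the function `g`." Until 2026-08-15 this file vendored that sentence literally, quantified over ALL
parameter functions `δ, Δ ≥ 2`, as the named fact
`def fi_asymptotic_sieve_primes : Prop := ∀ A D δ Δ H, A.FIAsymptoticSieveHypotheses D δ Δ →
A.HasDensityConstant H → (∑_{p ≤ x} a_p log p - H A(x)) =O[atTop] (H A(x) log δ(x) / log Δ(x))`.
Read that way the statement is FALSE, and the tree PROVES it:
`Literature.NumberTheory.Sieve.not_fi_asymptotic_sieve_primes` (alias
`Literature.NumberTheory.Sieve.fi_asymptotic_sieve_primes_false`) in
`AsymptoticSieveForPrimesCounterexample.lean` states `¬ (that ∀-statement)` verbatim and proves it —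
nothing ties the size of the error `log δ / log Δ` to the strength of (B): for the squarefree numbers
(`a_n = μ²(n)`, `g(p) = 1/(p+1)`, `D = x^{3/4}`, `H = ∏_p p²/(p²-1)`) every clause of
`FIAsymptoticSieveHypotheses` holds with `δ(x) = 2√x` (the range (B1) then contains no `N` with an
integer in `(N, 2N]`, so (B) is vacuous) and `Δ(x) = exp(x³)`, while `∑_{p ≤ x} log p - H A(x)` jumps by
`log p - H → ∞` at every prime and so is not `O(H A(x) log(2√x) / x³) = o(1)`. The refuted `def` was
therefore RETIRED from this file (D-0026 verdict clean-up, 2026-08-15: a refuted named fact is deleted,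
its `¬`-theorem kept), together with its only in-file use, the ex-falso specialisation
`fi_asymptotic_sieve_primes.loglog : fi_asymptotic_sieve_primes → fi_asymptotic_sieve_primes_loglog`.

What FI prove is the theorem in its working regime, which the printed text names on the same page:
"In practice (B) can be established in the range (B1) for `δ = (log x)^α` and `Δ = x^η` with some
positive constants `α, η`. For these choices the error term in (1.17) becomes `O(log log x / log x)` …
If `log δ(x) ≫ log Δ(x)` then the error term exceeds the main term and (1.17) follows from the upper
bound sieve. Therefore for the proof we may assume that `x > Δ(x)^A`, `Δ(x) > δ(x)^A`, and `δ(x) > A`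
for any fixed positive constant `A`" (FI p. 1044; likewise Friedlander–Iwaniec, Ann. of Math. 148
(1998) 945–1040, after Prop. 2.1: "In practice `δ` is a large power of `log x` and `Δ` is a small
power of `x`"; Harman, *Prime-Detecting Sieves*, Thm 12.3 and the Remark after Thm 12.5:
`δ_H = (log x)^{-J}`, `η = x^{-1/24+ε}`), where the Vaughan parameters `y = z ≍ √D / Δ` tend to
infinity and the primes `≤ Δ ≤ √x` are negligible by (1.4); the witness above has `Δ > x`. The named
fact below is Theorem 1 in exactly that regime; it is DISCHARGED in the tree
(`Literature.NumberTheory.Sieve.fi_asymptotic_sieve_primes_loglog_holds`,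
`AsymptoticSieveForPrimesTheorem1.lean`, assembling FI §§2–8). -/

/-- **Friedlander–Iwaniec, asymptotic sieve for primes, Theorem 1, in the regime `δ = (log x)^α`,
`Δ = x^θ`** (named fact, discharged downstream as `fi_asymptotic_sieve_primes_loglog_holds`; the
corrected form of the retired literal reading `fi_asymptotic_sieve_primes`, see the section docstring
above for the discrepancy). Let `A = (a_n)` be a nonnegative sequence supported on squarefree
integers satisfying (1.4), (1.6)–(1.9), (R) with level `D(x)` (`x^{2/3} < D(x) < x`, (R1)) and (B) for
every `1 ≤ C ≤ x/D` (B3) and every `N` with `x^{-θ} √D < N < (log x)^{-α} √x` (B1), where `α > 0` and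
`0 < θ < 1/3` are fixed (so `√D / Δ > x^{1/3-θ} → ∞`); let `H = ∏_p (1 - g(p))(1 - 1/p)⁻¹`
(`SieveSequence.HasDensityConstant`). Then
`∑_{p ≤ x} a_p log p = H A(x) (1 + O(log log x / log x))`,
i.e. FI (1.17) `H A(x)(1 + O(log δ / log Δ))` with `log δ / log Δ = (α/θ) log log x / log x`; the
`IsBigO` constant may depend on `A, D, α, θ` (FI: on `g` only — implied by, never stronger than, the
printed uniformity). [cite: FriedlanderIwaniecASP1998, Theorem 1 (1.17)] -/
def fi_asymptotic_sieve_primes_loglog : Prop :=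
  ∀ (A : SieveSequence) (D : ℝ → ℝ) (α θ H : ℝ), 0 < α → 0 < θ → θ < 1 / 3 →
    A.FIAsymptoticSieveHypotheses D (fun x => Real.log x ^ α) (fun x => x ^ θ) →
      A.HasDensityConstant H →
      (fun x : ℝ => (∑ p ∈ Nat.primesLE ⌊x⌋₊, A.a p * Real.log p) - H * A.size x) =O[atTop]
        fun x : ℝ => H * A.size x * (Real.log (Real.log x) / Real.log x)

end Literature.NumberTheory.Sieve
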